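import Summits.KontsevichZagierPeriods.KontsevichZagierPeriods.Theses.HurwitzMicroSectors
import Summits.KontsevichZagierPeriods.KontsevichZagierPeriods.Theorems.HurwitzMicroSectorsNormalFormPrinciplePiBoxTransfer
import Summits.KontsevichZagierPeriods.KontsevichZagierPeriods.Theorems.HurwitzMicroSectorsNormalFormPrincipleVariants2283
import Summits.KontsevichZagierPeriods.KontsevichZagierPeriods.Theorems.HurwitzMicroSectorsNormalFormPrincipleVariants2320

/-! TTRL-lite variant V2280 of stmt-KontsevichZagierPeriods-3869

Variant V2280 = `stub_boxRigidity` (the leaf `BoxRigidity` of `NormalFormPrinciple`: two representations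
on open unit boxes with integrands of KZ's rational shape `p/q` over `ℚ`, `q ≠ 0` on the box, and equal
values are KZ-equivalent) with BOTH dimensions frozen, `fix m := 4; fix m' := 8`. Verdict of the attempt
seat: **open** — this file is the exact-strength certificate, not a proof of the variant. By the general
pair lemma of the sibling certificate `…Variants2283` (`boxRigidityPair_iff_boxVanishingDim K m₀`: a
two-sided freeze is exactly `BoxVanishing (max K m₀)` — compare with the zero representation on the other
box for (⇒); pad both representations to the larger box by unit intervals, one Newton–Leibniz move each,
and subtract there by rule 1b for (⇐)), with `max 4 8 = 8`:
`V2280 ⟺ BoxVanishing 8 ⟺ BoxRigidity(m, m' ≤ 8) ⟺ V2320 ⟺ mirror (8, 4)`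
(`stub_boxRigidity_var2280_iff_boxVanishing_eight`, `…_iff_le_eight`, `…_iff_var2320`, `…_iff_mirror`):
every `ℚ`-rational absolutely convergent `∫_{(0,1)⁸} p/q` of value `0` is generated by the four moves. By
monotonicity along padding this contains every dimension `≤ 8`
(`boxVanishing_le_eight_of_stub_boxRigidity_var2280`), in particular the level `2` (vanishing rational
combinations of `π²`, Catalan's `G`, `Li₂` at rationals, `log·log`, `L(2,χ)`, … inside integrands): a proof
needs either the open independence statements it quantifies over or move-certificates that would PROVE a
dependence; the tree's knowledge stops at `m, m' ≤ 1` (`boxRigidity_of_le_one`, Baker). Conversely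
`KontsevichZagierPeriods → V2280` (`stub_boxRigidity_var2280_of_statement`), so a refutation of the variant
would refute the Summit, and the tree has no invariant of `KZ.relations` finer than `eval`
(`relations_le_ker_eval_holds`): neither side is reachable here.
Source: M. Kontsevich, D. Zagier, *Periods* (2001), §1.2 Conjecture 1. Pure proof file, no definitions. -/

-- `Summit.<Summit>.<Problem>` is the tree's mandated summit-side namespace (CONVENTIONS §2); for this
-- single-conjunct summit the two coincide, so the duplicate is deliberate.
set_option linter.dupNamespace false

noncomputable section

namespace Summit.KontsevichZagierPeriods.KontsevichZagierPeriods.Theorems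

open MeasureTheory Set
open Literature.NumberTheory.Transcendental Literature.NumberTheory.Transcendental.KZ
open Summit.KontsevichZagierPeriods.KontsevichZagierPeriods.Theses.HurwitzMicroSectors
open Summit.KontsevichZagierPeriods.HurwitzMicroSectors.NormalFormPrinciple.PiBox

/-! ## The variant V2280: exactly `BoxVanishing 8` -/

/-- **V2280 ⟺ `BoxVanishing 8`**: a box-rational representation on the `8`-box of value `0` is a
relation (`boxRigidityPair_iff_boxVanishingDim 4 8`, `max 4 8 = 8`).
[cite: KontsevichZagier2001, §1.2 Conjecture 1] -/
theorem stub_boxRigidity_var2280_iff_boxVanishing_eight :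
    (∀ (N : IntegralRep 4) (N' : IntegralRep 8), N.domain = {x | ∀ i, x i ∈ Set.Ioo (0:ℝ) 1} → N.IsRational → N'.domain = {x | ∀ i, x i ∈ Set.Ioo (0:ℝ) 1} → N'.IsRational → N.value = N'.value → Equivalent N N') ↔
    (∀ (M : IntegralRep 8), M.domain = {x | ∀ i, x i ∈ Set.Ioo (0:ℝ) 1} →
      M.IsRational → M.value = 0 → of M ∈ relations) :=
  boxRigidityPair_iff_boxVanishingDim 4 8

/-- **V2280 ⟺ the two-sided bounded leaf `BoxRigidity(m, m' ≤ 8)`** (the honest strength of the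
variant: Conjecture 1 for all pairs of rational integrands on the open unit boxes of dimension at most
`8`; freezing the pair `(4, 8)` loses nothing below dimension `8`) — strictly between the tree's theorem
`boxRigidity_of_le_one` (`m, m' ≤ 1`, Baker) and the full leaf. [cite: KontsevichZagier2001, §1.2 Conjecture 1] -/
theorem stub_boxRigidity_var2280_iff_le_eight :
    (∀ (N : IntegralRep 4) (N' : IntegralRep 8), N.domain = {x | ∀ i, x i ∈ Set.Ioo (0:ℝ) 1} → N.IsRational → N'.domain = {x | ∀ i, x i ∈ Set.Ioo (0:ℝ) 1} → N'.IsRational → N.value = N'.value → Equivalent N N') ↔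
    (∀ (m m' : ℕ) (N : IntegralRep m) (N' : IntegralRep m'), m ≤ 8 → m' ≤ 8 →
      N.domain = {x | ∀ i, x i ∈ Set.Ioo (0:ℝ) 1} → N.IsRational →
      N'.domain = {x | ∀ i, x i ∈ Set.Ioo (0:ℝ) 1} → N'.IsRational →
      N.value = N'.value → Equivalent N N') :=
  boxRigidityPair_iff_boxRigidityLe 4 8

/-- **V2280 ⟺ its mirror `fix m := 8; fix m' := 4`**: both pairs freeze to `BoxVanishing 8`
(`max 4 8 = max 8 4 = 8`; equivalently, `Equivalent` is symmetric).
[cite: KontsevichZagier2001, §1.2 Conjecture 1] -/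
theorem stub_boxRigidity_var2280_iff_mirror :
    (∀ (N : IntegralRep 4) (N' : IntegralRep 8), N.domain = {x | ∀ i, x i ∈ Set.Ioo (0:ℝ) 1} → N.IsRational → N'.domain = {x | ∀ i, x i ∈ Set.Ioo (0:ℝ) 1} → N'.IsRational → N.value = N'.value → Equivalent N N') ↔
    (∀ (N : IntegralRep 8) (N' : IntegralRep 4), N.domain = {x | ∀ i, x i ∈ Set.Ioo (0:ℝ) 1} →
      N.IsRational → N'.domain = {x | ∀ i, x i ∈ Set.Ioo (0:ℝ) 1} → N'.IsRational →
      N.value = N'.value → Equivalent N N') :=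
  ⟨fun h N N' hNd hNr hN'd hN'r hv => (h N' N hN'd hN'r hNd hNr hv.symm).symm,
    fun h N N' hNd hNr hN'd hN'r hv => (h N' N hN'd hN'r hNd hNr hv.symm).symm⟩

/-- **V2280 ⟺ V2320** (`fix m := 8; bound m' ≤ 2`): both variants are `BoxVanishing 8`
(`stub_boxRigidity_var2320_iff_boxVanishing_eight`). [cite: KontsevichZagier2001, §1.2 Conjecture 1] -/
theorem stub_boxRigidity_var2280_iff_var2320 :
    (∀ (N : IntegralRep 4) (N' : IntegralRep 8), N.domain = {x | ∀ i, x i ∈ Set.Ioo (0:ℝ) 1} → N.IsRational → N'.domain = {x | ∀ i, x i ∈ Set.Ioo (0:ℝ) 1} → N'.IsRational → N.value = N'.value → Equivalent N N') ↔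
    (∀ (m' : ℕ) (N : IntegralRep 8) (N' : IntegralRep m'), m' ≤ 2 →
      N.domain = {x | ∀ i, x i ∈ Set.Ioo (0:ℝ) 1} → N.IsRational →
      N'.domain = {x | ∀ i, x i ∈ Set.Ioo (0:ℝ) 1} → N'.IsRational →
      N.value = N'.value → Equivalent N N') := by
  rw [stub_boxRigidity_var2280_iff_boxVanishing_eight, stub_boxRigidity_var2320_iff_boxVanishing_eight]

/-- **V2280 ⇒ `BoxVanishing` in every dimension `≤ 8`** (monotonicity along padding,
`boxVanishing_mono`); the first open level is `2`: every vanishing box-rational `∫∫_{(0,1)²} p/q` is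
generated by the moves (dilogarithm / Catalan-type relations). [cite: KontsevichZagier2001, §1.2 Conjecture 1] -/
theorem boxVanishing_le_eight_of_stub_boxRigidity_var2280
    (h : ∀ (N : IntegralRep 4) (N' : IntegralRep 8), N.domain = {x | ∀ i, x i ∈ Set.Ioo (0:ℝ) 1} → N.IsRational → N'.domain = {x | ∀ i, x i ∈ Set.Ioo (0:ℝ) 1} → N'.IsRational → N.value = N'.value → Equivalent N N')
    {j : ℕ} (hj : j ≤ 8) (N : IntegralRep j) (hNd : N.domain = {x | ∀ i, x i ∈ Set.Ioo (0:ℝ) 1})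
    (hNr : N.IsRational) (hv : N.value = 0) : of N ∈ relations :=
  boxVanishing_mono hj (stub_boxRigidity_var2280_iff_boxVanishing_eight.1 h) N hNd hNr hv

/-- **`BoxVanishing 8` ⇒ V2280** (the converse reading of the certificate, in the form a future proof
of the dimension-`8` kernel statement would be consumed). [cite: KontsevichZagier2001, §1.2 Conjecture 1] -/
theorem stub_boxRigidity_var2280_of_boxVanishing_eight
    (hvan : ∀ (M : IntegralRep 8), M.domain = {x | ∀ i, x i ∈ Set.Ioo (0:ℝ) 1} → M.IsRational →
      M.value = 0 → of M ∈ relations) :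
    ∀ (N : IntegralRep 4) (N' : IntegralRep 8), N.domain = {x | ∀ i, x i ∈ Set.Ioo (0:ℝ) 1} → N.IsRational → N'.domain = {x | ∀ i, x i ∈ Set.Ioo (0:ℝ) 1} → N'.IsRational → N.value = N'.value → Equivalent N N' :=
  stub_boxRigidity_var2280_iff_boxVanishing_eight.2 hvan

/-- **The parent leaf ⇒ V2280** (specialisation `m = 4`, `m' = 8`).
[cite: KontsevichZagier2001, §1.2 Conjecture 1] -/
theorem stub_boxRigidity_var2280_of_parent
    (h : ∀ (m m' : ℕ) (N : IntegralRep m) (N' : IntegralRep m'), N.domain = {x | ∀ i, x i ∈ Set.Ioo (0:ℝ) 1} → N.IsRational → N'.domain = {x | ∀ i, x i ∈ Set.Ioo (0:ℝ) 1} → N'.IsRational → N.value = N'.value → Equivalent N N') :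
    ∀ (N : IntegralRep 4) (N' : IntegralRep 8), N.domain = {x | ∀ i, x i ∈ Set.Ioo (0:ℝ) 1} → N.IsRational → N'.domain = {x | ∀ i, x i ∈ Set.Ioo (0:ℝ) 1} → N'.IsRational → N.value = N'.value → Equivalent N N' :=
  h 4 8

/-- **`KontsevichZagierPeriods ⇒ V2280`**: the variant is a special case of Conjecture 1 for the
tree's calculus (`leaves_of_statement`) — so a refutation of the variant would refute the Summit.
[cite: KontsevichZagier2001, §1.2 Conjecture 1] -/
theorem stub_boxRigidity_var2280_of_statement (h : _root_.KontsevichZagierPeriods) :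
    ∀ (N : IntegralRep 4) (N' : IntegralRep 8), N.domain = {x | ∀ i, x i ∈ Set.Ioo (0:ℝ) 1} → N.IsRational → N'.domain = {x | ∀ i, x i ∈ Set.Ioo (0:ℝ) 1} → N'.IsRational → N.value = N'.value → Equivalent N N' :=
  (leaves_of_statement h).1 4 8

end Summit.KontsevichZagierPeriods.KontsevichZagierPeriods.Theorems

end
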